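import Mathlib
import Summits.NavierStokesRegularity.NavierStokesRegularity.Theses.AffineBernoulli
import Literature.Analysis.FluidPDE.DecayingSelfSimilarEulerProfile
import HarnessLib

/-!
# `AffineBernoulli.AffineBernoulliIdentities` — the Bernoulli identity (B) and the vorticity
  commutator (C) of a `γ = ½` self-similar Euler profile (route `AffineBernoulli`,
  item stmt-NavierStokesRegularity-13664, support; card P1)

For `W ∈ C²`, `P ∈ C¹`, `div W = 0` solving the `γ = ½` profile equation
`½W + DW·V + ∇P = 0`, `V = ½(y − c) + W`, with `Ω = curl W` and
`ℋ(z) = ½‖½(z − c) + W(z)‖² + P(z) − ⅛‖z − c‖²`: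
(B) `∇ℋ = −Ω × V`; (C) `DΩ·V − DW·Ω = −Ω`.

PROOF. Both identities are in the tree's transcription of Constantin–Ignatova–Vicol, §3
(`Literature/Analysis/FluidPDE/DecayingSelfSimilarEulerProfile.lean`): the hypotheses say
`IsSelfSimilarEulerProfile (1/2) c W P` (`isSelfSimilarEulerProfile_half_iff`), and then (B) is
`IsSelfSimilarEulerProfile.gradient_selfSimilarBernoulli_half` (the Bernoulli form (3.29) at
`γ = ½`) and (C) is `IsSelfSimilarEulerProfile.vorticity_eq_sub_form` (the curl of (3.3), (3.4)).
No decay is used.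

HONEST FRAMING: calculus identities for a HYPOTHETICAL profile; nothing here bears on the
regularity problem itself.
-/

noncomputable section

set_option linter.dupNamespace false

namespace Summit.NavierStokesRegularity.NavierStokesRegularity.Theorems

open Literature.Analysis Literature.Analysis.FluidPDE

/-- **Item stmt-NavierStokesRegularity-13664** (`AffineBernoulli.AffineBernoulliIdentities`;
CIV §3 at `γ = ½`): (B) `∇ℋ = −Ω × V` and (C) `DΩ·V − DW·Ω = −Ω` for a `γ = ½` self-similar Euler
profile. [this file; ConstantinIgnatovaVicol2026Putative §3.1.1 (3.4), §3.4.3 (3.29)] -/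
theorem affineBernoulli_affineBernoulliIdentities_proof :
    Summit.NavierStokesRegularity.NavierStokesRegularity.Theses.AffineBernoulli.AffineBernoulliIdentities := by
  unfold Summit.NavierStokesRegularity.NavierStokesRegularity.Theses.AffineBernoulli.AffineBernoulliIdentities
  intro c W P hW hP hdiv heq y
  have h : IsSelfSimilarEulerProfile (1 / 2) c W P :=
    isSelfSimilarEulerProfile_half_iff.2 ⟨hW, hP, hdiv, heq⟩
  refine ⟨h.gradient_selfSimilarBernoulli_half y, ?_⟩
  have hC := h.vorticity_eq_sub_form y
  exact hC

end Summit.NavierStokesRegularity.NavierStokesRegularity.Theorems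

end
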